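import Summits.ValiantsHypothesis.ValiantsHypothesis.Theorems.LacunarySymmetroidMatrixDescartesDoorA26WallBubblingInsertTwo
import Summits.ValiantsHypothesis.ValiantsHypothesis.Theorems.LacunarySymmetroidMatrixDescartesDoorA26WallBubblingQuadZeroLift
import Summits.ValiantsHypothesis.ValiantsHypothesis.Theorems.LacunarySymmetroidMatrixDescartesDoorA26WallBubblingScalingLimit

/-!
# `DoorA26` / line `wall_bubbling` — the SECOND-ORDER-FAMILY ORDER-3 OPENING THEOREM (`S + ηT₁ + η²T₂` at a triple zero; no slope sign needed)

HONEST FRAMING.  Object-search cell `pub-symmetroid`, crux `Theses.LacunarySymmetroid.DoorA26` (stmt-ValiantsHypothesis-19979; OPEN, typed,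
never asserted).  W2 seat val-sym-door-p1 g19, file #74; def-free helper for obligation (R) of `Cruxes/DoorA26/Lines/wall_bubbling.lean`.
Memo `DOOR-A26-P1G19-NO-BALANCE.md` §7d(1): #50 opens a triple zero with a LINEAR family and needs the slope SIGN `ab < 0` of `pol(P,T)` at `t⋆`;
with a second-order family the slope may VANISH (`c₁(t⋆) = c₁′(t⋆) = 0`, two equalities) provided `c₂(t⋆) = 0` and the cubic SCALING POLYNOMIAL
`M(σ) = aσ³ + B₂σ² + e₁σ + e₃` (`c₀‴(t⋆) = 6a`, `c₁″(t⋆) = 2B₂`, `c₂′(t⋆) = e₁`, `c₃(t⋆) = e₃`; blow-up `t = t⋆ + ησ`, `α = 1`, `β = 3`) takes the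
signs `aM(σ_L) > 0 > aM(σ_R)` at some `σ_L < σ_R` (three real roots) — `e₁` and `e₃` are supplied by `T₂`, which is invisible at first-order
touches and at nodes.  Imports #73 `…InsertTwo` (frame) and #72 `…QuadZeroLift` (the `η`-expansion and the poly-sign helper; hence #70, #71).

WHAT IS HERE.  ★ `mem_twentyLocus_of_cubicZero_secondOrder`.  Nothing here bears on `DoorA26`, `DoorA34`, (W)/(M)/(R), `MatrixDescartes`
(18050) or `VP ≠ VNP`; registers unchanged.

[folklore] Newton polygon / Taylor.  [this work] the theorem.
-/

set_option linter.dupNamespace false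

namespace Summit.ValiantsHypothesis.ValiantsHypothesis.Theorems.LacunarySymmetroidMatrixDescartes.WallBubbling

open Finset Filter Topology
open Bubbling (TwentyLocus expSum)

/-- ★ **THE SECOND-ORDER-FAMILY ORDER-3 OPENING THEOREM** (see the module docstring for the reading). [this work] -/
theorem mem_twentyLocus_of_cubicZero_secondOrder (δ : Fin 6 → ℝ) (S T₁ T₂ : Fin 6 → Matrix (Fin 2) (Fin 2) ℝ)
    (hS : ∀ l, (S l).IsSymm) (hT₁ : ∀ l, (T₁ l).IsSymm) (hT₂ : ∀ l, (T₂ l).IsSymm)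
    (τ : Fin 19 → ℝ) (hτ : StrictMono τ) (jstar : Fin 18) (tstar : ℝ)
    (ht1 : τ jstar.castSucc < tstar) (ht2 : tstar < τ jstar.succ)
    (κ : Fin 19 → ℝ) (halt : ∀ j : Fin 18, κ j.castSucc * κ j.succ < 0)
    (hout : ∀ j,
      0 < κ j * (∑ l, Real.exp (δ l * τ j) • S l).det ∨
      ((∑ l, Real.exp (δ l * τ j) • S l).det = 0 ∧
        0 < κ j * (((∑ l, Real.exp (δ l * τ j) • S l) + (∑ l, Real.exp (δ l * τ j) • T₁ l)).det
              - (∑ l, Real.exp (δ l * τ j) • S l).det - (∑ l, Real.exp (δ l * τ j) • T₁ l).det)) ∨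
      ((∑ l, Real.exp (δ l * τ j) • S l).det = 0 ∧
        ((∑ l, Real.exp (δ l * τ j) • S l) + (∑ l, Real.exp (δ l * τ j) • T₁ l)).det
              - (∑ l, Real.exp (δ l * τ j) • S l).det - (∑ l, Real.exp (δ l * τ j) • T₁ l).det = 0 ∧
        0 < κ j * ((((∑ l, Real.exp (δ l * τ j) • S l) + (∑ l, Real.exp (δ l * τ j) • T₂ l)).det
              - (∑ l, Real.exp (δ l * τ j) • S l).det - (∑ l, Real.exp (δ l * τ j) • T₂ l).det)
              + (∑ l, Real.exp (δ l * τ j) • T₁ l).det)))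
    (a B₂ e₁ e₃ σL σR : ℝ) (haκ : a * κ jstar.castSucc < 0)
    (hD0 : (∑ l, Real.exp (δ l * tstar) • S l).det = 0)
    (hD1 : deriv (fun t => (∑ l, Real.exp (δ l * t) • S l).det) tstar = 0)
    (hD2 : iteratedDeriv 2 (fun t => (∑ l, Real.exp (δ l * t) • S l).det) tstar = 0)
    (hD3 : iteratedDeriv 3 (fun t => (∑ l, Real.exp (δ l * t) • S l).det) tstar = 6 * a)
    (hB0 : ((∑ l, Real.exp (δ l * tstar) • S l) + (∑ l, Real.exp (δ l * tstar) • T₁ l)).det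
              - (∑ l, Real.exp (δ l * tstar) • S l).det - (∑ l, Real.exp (δ l * tstar) • T₁ l).det = 0)
    (hB1 : deriv (fun t => ((∑ l, Real.exp (δ l * t) • S l) + (∑ l, Real.exp (δ l * t) • T₁ l)).det
              - (∑ l, Real.exp (δ l * t) • S l).det - (∑ l, Real.exp (δ l * t) • T₁ l).det) tstar = 0)
    (hB2 : iteratedDeriv 2 (fun t => ((∑ l, Real.exp (δ l * t) • S l) + (∑ l, Real.exp (δ l * t) • T₁ l)).det
              - (∑ l, Real.exp (δ l * t) • S l).det - (∑ l, Real.exp (δ l * t) • T₁ l).det) tstar = 2 * B₂)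
    (hC0 : (((∑ l, Real.exp (δ l * tstar) • S l) + (∑ l, Real.exp (δ l * tstar) • T₂ l)).det
              - (∑ l, Real.exp (δ l * tstar) • S l).det - (∑ l, Real.exp (δ l * tstar) • T₂ l).det)
              + (∑ l, Real.exp (δ l * tstar) • T₁ l).det = 0)
    (hC1 : deriv (fun t => (((∑ l, Real.exp (δ l * t) • S l) + (∑ l, Real.exp (δ l * t) • T₂ l)).det
              - (∑ l, Real.exp (δ l * t) • S l).det - (∑ l, Real.exp (δ l * t) • T₂ l).det)
              + (∑ l, Real.exp (δ l * t) • T₁ l).det) tstar = e₁)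
    (hE0 : ((∑ l, Real.exp (δ l * tstar) • T₁ l) + (∑ l, Real.exp (δ l * tstar) • T₂ l)).det
              - (∑ l, Real.exp (δ l * tstar) • T₁ l).det - (∑ l, Real.exp (δ l * tstar) • T₂ l).det = e₃)
    (hσ : σL < σR) (hσL : σL ≠ 0) (hσR : σR ≠ 0)
    (hML : 0 < a * (a * σL ^ 3 + B₂ * σL ^ 2 + e₁ * σL + e₃)) (hMR : a * (a * σR ^ 3 + B₂ * σR ^ 2 + e₁ * σR + e₃) < 0) :
    δ ∈ TwentyLocus := by
  classical
  -- abbreviations for the three pencils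
  set P : ℝ → Matrix (Fin 2) (Fin 2) ℝ := fun t => ∑ l, Real.exp (δ l * t) • S l with hP
  set Q₁ : ℝ → Matrix (Fin 2) (Fin 2) ℝ := fun t => ∑ l, Real.exp (δ l * t) • T₁ l with hQ₁
  set Q₂ : ℝ → Matrix (Fin 2) (Fin 2) ℝ := fun t => ∑ l, Real.exp (δ l * t) • T₂ l with hQ₂
  -- the coefficient functions
  set c₀ : ℝ → ℝ := fun t => (P t).det with hc₀
  set c₁ : ℝ → ℝ := fun t => (P t + Q₁ t).det - (P t).det - (Q₁ t).det with hc₁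
  set c₂ : ℝ → ℝ := fun t => ((P t + Q₂ t).det - (P t).det - (Q₂ t).det) + (Q₁ t).det with hc₂
  set c₃ : ℝ → ℝ := fun t => (Q₁ t + Q₂ t).det - (Q₁ t).det - (Q₂ t).det with hc₃
  set c₄ : ℝ → ℝ := fun t => (Q₂ t).det with hc₄
  -- the family and its determinant
  let Sη : ℝ → Fin 6 → Matrix (Fin 2) (Fin 2) ℝ := fun η l => S l + η • T₁ l + η ^ 2 • T₂ l
  have hSη : ∀ η l, (Sη η l).IsSymm := fun η l => ((hS l).add ((hT₁ l).smul η)).add ((hT₂ l).smul (η ^ 2))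
  have hdet : ∀ η t, (∑ l, Real.exp (δ l * t) • Sη η l).det
      = c₀ t + η * c₁ t + η ^ 2 * c₂ t + η ^ 3 * c₃ t + η ^ 4 * c₄ t := by
    intro η t
    show (∑ l, Real.exp (δ l * t) • (S l + η • T₁ l + η ^ 2 • T₂ l)).det = _
    rw [expPencil_add_smul_add_smul, det_add_smul_add_smul_fin_two]
  -- exponential-sum representations (Leibniz index)
  let ι := Equiv.Perm (Fin 2) × (Fin 2 → Fin 6)
  let x : ι → ℝ := fun p => ∑ i, δ (p.2 i)
  let lb : (Fin 6 → Matrix (Fin 2) (Fin 2) ℝ) → ι → ℝ := fun U p => ((Equiv.Perm.sign p.1 : ℤ) : ℝ) * ∏ i, U (p.2 i) (p.1 i) i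
  have hrep : ∀ U : Fin 6 → Matrix (Fin 2) (Fin 2) ℝ, (fun t => (∑ l, Real.exp (δ l * t) • U l).det) = expSum (lb U) x :=
    fun U => det_expPencil_eq_expSum_fun δ U
  have hPQ : ∀ (U V : Fin 6 → Matrix (Fin 2) (Fin 2) ℝ) (t : ℝ),
      (∑ l, Real.exp (δ l * t) • U l) + (∑ l, Real.exp (δ l * t) • V l) = ∑ l, Real.exp (δ l * t) • (U l + V l) :=
    fun U V t => expPencil_add δ U V t
  -- c₀, c₁, c₂, c₃, c₄ as exponential sums
  let a0 : ι → ℝ := lb S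
  let a1 : ι → ℝ := fun p => lb (fun l => S l + T₁ l) p - lb S p - lb T₁ p
  let a2 : ι → ℝ := fun p => (lb (fun l => S l + T₂ l) p - lb S p - lb T₂ p) + lb T₁ p
  let a3 : ι → ℝ := fun p => lb (fun l => T₁ l + T₂ l) p - lb T₁ p - lb T₂ p
  let a4 : ι → ℝ := lb T₂
  have ev : ∀ (U : Fin 6 → Matrix (Fin 2) (Fin 2) ℝ) (t : ℝ), (∑ l, Real.exp (δ l * t) • U l).det = expSum (lb U) x t :=
    fun U t => congrFun (hrep U) t
  have hc₀f : c₀ = expSum a0 x := funext fun t => ev S t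
  have hc₁f : c₁ = expSum a1 x := by
    funext t
    show (P t + Q₁ t).det - (P t).det - (Q₁ t).det = _
    rw [hP, hQ₁]; dsimp only
    rw [hPQ, ev, ev, ev, expSum_sub_sub]
  have hc₂f : c₂ = expSum a2 x := by
    funext t
    show ((P t + Q₂ t).det - (P t).det - (Q₂ t).det) + (Q₁ t).det = _
    rw [hP, hQ₁, hQ₂]; dsimp only
    rw [hPQ, ev, ev, ev, ev, expSum_sub_sub, expSum_add_coeff]
  have hc₃f : c₃ = expSum a3 x := by
    funext t
    show (Q₁ t + Q₂ t).det - (Q₁ t).det - (Q₂ t).det = _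
    rw [hQ₁, hQ₂]; dsimp only
    rw [hPQ, ev, ev, ev, expSum_sub_sub]
  have hc₄f : c₄ = expSum a4 x := funext fun t => ev T₂ t
  -- Taylor data as vanishing of the derivative sums
  have hmom : ∀ (b : ι → ℝ) (j : ℕ), expSum (fun i => b i * x i ^ j) x tstar = iteratedDeriv j (expSum b x) tstar :=
    fun b j => by rw [iteratedDeriv_expSum]
  have hD0' : iteratedDeriv 0 c₀ tstar = 0 := by rw [iteratedDeriv_zero]; exact hD0
  have hD1' : iteratedDeriv 1 c₀ tstar = 0 := by rw [iteratedDeriv_one]; exact hD1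
  have hB0' : iteratedDeriv 0 c₁ tstar = 0 := by rw [iteratedDeriv_zero]; exact hB0
  have hB1' : iteratedDeriv 1 c₁ tstar = 0 := by rw [iteratedDeriv_one]; exact hB1
  have hC0' : iteratedDeriv 0 c₂ tstar = 0 := by rw [iteratedDeriv_zero]; exact hC0
  have hC1' : iteratedDeriv 1 c₂ tstar = e₁ := by rw [iteratedDeriv_one]; exact hC1
  -- the five Taylor quotients
  have T0 : Tendsto (fun h => c₀ (tstar + h) / h ^ 3) (𝓝[≠] 0) (𝓝 a) := by
    have hv : ∀ j < 3, expSum (fun i => a0 i * x i ^ j) x tstar = 0 := by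
      intro j hj
      rw [hmom, ← hc₀f]
      interval_cases j
      · exact hD0'
      · exact hD1'
      · exact hD2
    have := tendsto_expSum_div_pow x tstar 3 a0 hv
    rw [hmom, ← hc₀f, hD3, show (Nat.factorial 3 : ℝ) = 6 by norm_num [Nat.factorial]] at this
    rw [hc₀f] at this ⊢
    convert this using 2; field_simp
  have T1 : Tendsto (fun h => c₁ (tstar + h) / h ^ 2) (𝓝[≠] 0) (𝓝 B₂) := by
    have hv : ∀ j < 2, expSum (fun i => a1 i * x i ^ j) x tstar = 0 := by
      intro j hj
      rw [hmom, ← hc₁f]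
      interval_cases j
      · exact hB0'
      · exact hB1'
    have := tendsto_expSum_div_pow x tstar 2 a1 hv
    rw [hmom, ← hc₁f, hB2, show (Nat.factorial 2 : ℝ) = 2 by norm_num [Nat.factorial]] at this
    rw [hc₁f] at this ⊢
    convert this using 2; field_simp
  have T2 : Tendsto (fun h => c₂ (tstar + h) / h ^ 1) (𝓝[≠] 0) (𝓝 e₁) := by
    have hv : ∀ j < 1, expSum (fun i => a2 i * x i ^ j) x tstar = 0 := by
      intro j hj
      rw [hmom, ← hc₂f]
      interval_cases j
      exact hC0'
    have := tendsto_expSum_div_pow x tstar 1 a2 hv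
    rw [hmom, ← hc₂f, hC1', Nat.factorial_one, Nat.cast_one, div_one] at this
    rwa [hc₂f] at this ⊢
  have Tk0 : ∀ (b : ι → ℝ), Tendsto (fun h => expSum b x (tstar + h) / h ^ 0) (𝓝[≠] 0) (𝓝 (expSum b x tstar)) := by
    intro b
    have := tendsto_expSum_div_pow x tstar 0 b (fun j hj => absurd hj (Nat.not_lt_zero j))
    simpa using this
  have T3 : Tendsto (fun h => c₃ (tstar + h) / h ^ 0) (𝓝[≠] 0) (𝓝 e₃) := by
    have := Tk0 a3; rw [← hc₃f] at this; rwa [← hE0]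
  have T4 : Tendsto (fun h => c₄ (tstar + h) / h ^ 0) (𝓝[≠] 0) (𝓝 (c₄ tstar)) := by
    have := Tk0 a4; rwa [← hc₄f] at this
  -- the scaling data on `Fin 5` (α = 1, β = 3)
  let cc : Fin 5 → ℝ → ℝ := ![fun h => c₀ (tstar + h), fun h => c₁ (tstar + h), fun h => c₂ (tstar + h),
    fun h => c₃ (tstar + h), fun h => c₄ (tstar + h)]
  let ee : Fin 5 → ℝ := ![0, 1, 2, 3, 4]
  let kk : Fin 5 → ℕ := ![3, 2, 1, 0, 0]
  let AA : Fin 5 → ℝ := ![a, B₂, e₁, e₃, c₄ tstar]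
  have hcc : ∀ i, Tendsto (fun h => cc i h / h ^ (kk i)) (𝓝[≠] 0) (𝓝 (AA i)) := by
    intro i; fin_cases i
    · exact T0
    · exact T1
    · exact T2
    · exact T3
    · exact T4
  have hβ : ∀ i : Fin 5, (3 : ℝ) ≤ ee i + (1 : ℝ) * kk i := by
    intro i; fin_cases i <;> simp [ee, kk] <;> norm_num
  have hMval : ∀ σ : ℝ, (∑ i : Fin 5, if ee i + (1 : ℝ) * kk i = 3 then AA i * σ ^ (kk i) else 0)
      = a * σ ^ 3 + B₂ * σ ^ 2 + e₁ * σ + e₃ := by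
    intro σ
    simp only [Fin.sum_univ_five, ee, kk, AA, Matrix.cons_val_zero, Matrix.cons_val_one, Matrix.head_cons,
      Matrix.cons_val_two, Matrix.tail_cons, Matrix.cons_val_three, Matrix.cons_val_four]
    norm_num
  -- the determinant at a moving abscissa is the scaling sum
  have hsum : ∀ (η : ℝ) (σ : ℝ), 0 < η →
      (∑ i : Fin 5, η ^ (ee i) * cc i (η ^ (1 : ℝ) * σ)) = (∑ l, Real.exp (δ l * (tstar + η * σ)) • Sη η l).det := by
    intro η σ hη
    rw [hdet, Fin.sum_univ_five, Real.rpow_one]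
    simp only [ee, cc, Matrix.cons_val_zero, Matrix.cons_val_one, Matrix.head_cons, Matrix.cons_val_two, Matrix.tail_cons,
      Matrix.cons_val_three, Matrix.cons_val_four]
    rw [Real.rpow_zero, show (1 : ℝ) = ((1 : ℕ) : ℝ) by norm_num, show (2 : ℝ) = ((2 : ℕ) : ℝ) by norm_num,
      show (3 : ℝ) = ((3 : ℕ) : ℝ) by norm_num, show (4 : ℝ) = ((4 : ℕ) : ℝ) by norm_num,
      Real.rpow_natCast, Real.rpow_natCast, Real.rpow_natCast, Real.rpow_natCast]
    ring
  -- signs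
  have hκL : 0 < -κ jstar.castSucc * (a * σL ^ 3 + B₂ * σL ^ 2 + e₁ * σL + e₃) := by
    by_contra h
    push Not at h
    nlinarith [mul_neg_of_neg_of_pos haκ hML, sq_nonneg a, h, mul_nonneg (sq_nonneg a) (neg_nonneg.2 h)]
  have hκR : 0 < κ jstar.castSucc * (a * σR ^ 3 + B₂ * σR ^ 2 + e₁ * σR + e₃) := by
    by_contra h
    push Not at h
    nlinarith [mul_pos_of_neg_of_neg haκ hMR, sq_nonneg a, h, mul_nonneg (sq_nonneg a) (neg_nonneg.2 h)]
  -- the width ε(η) = η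
  have hεt : Tendsto (fun η : ℝ => η) (𝓝[>] 0) (𝓝 0) := tendsto_id.mono_left nhdsWithin_le_nhds
  have hεpos : ∀ᶠ η in 𝓝[>] (0 : ℝ), 0 < η := eventually_mem_nhdsWithin
  refine mem_twentyLocus_of_insert_two δ Sη hSη τ hτ jstar tstar ht1 ht2 (fun η => η) hεt hεpos σL σR hσ κ halt ?_ ?_ ?_
  · -- outer abscissae
    intro j
    have := eventually_kappa_pos_poly4 (c₀ (τ j)) (c₁ (τ j)) (c₂ (τ j)) (c₃ (τ j)) (c₄ (τ j)) (κ j) (hout j)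
    exact this.mono fun η hη => by rw [hdet]; exact hη
  · -- t⋆ + ησ_L
    have h := eventually_kappa_pos_scaling cc ee kk AA (by norm_num : (0 : ℝ) < 1) hσL hcc 3 hβ
      (-κ jstar.castSucc) (by rw [hMval]; exact hκL)
    filter_upwards [h, self_mem_nhdsWithin] with η hη hη0
    rw [hsum η σL hη0] at hη
    simpa using hη
  · -- t⋆ + ησ_R
    have h := eventually_kappa_pos_scaling cc ee kk AA (by norm_num : (0 : ℝ) < 1) hσR hcc 3 hβ
      (κ jstar.castSucc) (by rw [hMval]; exact hκR)
    filter_upwards [h, self_mem_nhdsWithin] with η hη hη0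
    rw [hsum η σR hη0] at hη
    simpa using hη

end Summit.ValiantsHypothesis.ValiantsHypothesis.Theorems.LacunarySymmetroidMatrixDescartes.WallBubbling
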